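import Literature.MathematicalPhysics.QuantumFieldTheory.Balaban1983to89.B10Eq22Rescaling

/-!
# TASK T-S5/U5.4d «Haar density flatness» (`HaarDensityFlat`), typed verbatim from the planner's text and PROVED

Planner ym-idea-2 g17, bus `ym-idea-2/INBOX.md` 2026-08-29T17:01:45Z (T-S5.4 bricks, 4d): *"`HaarDensityFlat : ∃ C : ℝ, ∀ t : ℝ,
|t| ≤ 1 → |Real.log ((2 * Real.pi ^ 2) * sigmaSU2 t) + t ^ 2 / 3| ≤ C * t ^ 4` (log sinc² t = −t²/3 − t⁴/90 − …; this is what makes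
the product Jacobian Π_x 2π²σ(|A_x|) = exp(−Σ|A_x|²/3 + O(Σ|A_x|⁴)) a Gaussian factor of relative weight O(H⁴/β) in T-S5.4)"* — here
`sigmaSU2 r = (2π²)⁻¹ (sin r / r)²` (`= (2π²)⁻¹` at `r = 0`) is the printed Haar density of `SU(2)` in exponential coordinates
(`Literature…Balaban1983to89.B10Eq22Rescaling.sigmaSU2`, [Balaban1985UV3] p. 260; that it IS the Haar density:
✓`B10Eq18SigmaSU2Haar.map_expPauli_sigmaMeasure`).  Brick 4d of step (1b) (T-S5.4, Laplace asymptotics of the orbit average) of the XL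
comparison stubs S5 (LINE-19 ⟨stmt-QuantumFields-24004⟩/⟨24335⟩) and U5 (LINE-20 ⟨24336⟩).

Proved here: **`haarDensityFlat : HaarDensityFlat`** with the constant `C = 1` (`haarDensityFlat_one`).  One-dimensional real analysis from
Mathlib: `Real.sin_bound` (`|sin t − (t − t³/6)| ≤ |t|⁵/100` on `|t| ≤ 1`) gives `sin t / t = 1 − t²/6 + e` with `|e| ≤ t⁴/100`;
`Real.abs_log_sub_add_sum_range_le` (order 1: `|u + log(1 − u)| ≤ u²/(1 − |u|)`) with `u = t²/6 − e`, `|u| ≤ 1/5`; hence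
`|log (sin t/t)² + t²/3| = |2(u + log(1 − u)) − 2(u − t²/6)| ≤ (5/2)u² + t⁴/50 ≤ t⁴`.

HONEST LABEL: an elementary brick; T-S5.4 proper, S5, U5 and the cruxes ⟨24004⟩ ⟨24335⟩ ⟨24336⟩ remain OPEN; no summit is proved; the
Yang–Mills mass gap is NOT proved by this file.  Seat ym-line-sfw-p2-w5 g21 (cell ym-idea-1).
-/

set_option autoImplicit false

noncomputable section

open Literature.MathematicalPhysics.QuantumFieldTheory.Balaban1983to89.B10Eq22Rescaling (sigmaSU2)

namespace Summit.QuantumFields.YangMills.Theorems.AllWindowsColdBoxBoxHighLine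

/-- T-S5.4d **(Haar density flatness; S)** — typed verbatim from the planner's text: `log (2π² σ_{SU(2)}(t)) = −t²/3 + O(t⁴)` on
`|t| ≤ 1`. -/
def HaarDensityFlat : Prop :=
  ∃ C : ℝ, ∀ t : ℝ, |t| ≤ 1 → |Real.log ((2 * Real.pi ^ 2) * sigmaSU2 t) + t ^ 2 / 3| ≤ C * t ^ 4

/-- `2π² σ_{SU(2)}(t) = (sin t / t)²` (`= 1` at `t = 0`). -/
theorem two_pi_sq_mul_sigmaSU2 (t : ℝ) :
    (2 * Real.pi ^ 2) * sigmaSU2 t = (if t = 0 then 1 else Real.sin t / t) ^ 2 := by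
  unfold sigmaSU2
  have hπ : (2 * Real.pi ^ 2 : ℝ) ≠ 0 := by positivity
  rw [← mul_assoc, mul_one_div_cancel hπ, one_mul]

/-- The `sinc` expansion to fourth order: `|sin t / t − (1 − t²/6)| ≤ t⁴/100` for `0 < |t| ≤ 1` (`Real.sin_bound`). -/
theorem abs_sin_div_sub_le {t : ℝ} (ht : |t| ≤ 1) (h0 : t ≠ 0) :
    |Real.sin t / t - (1 - t ^ 2 / 6)| ≤ t ^ 4 / 100 := by
  have hb := Real.sin_bound ht
  have hid : Real.sin t / t - (1 - t ^ 2 / 6) = (Real.sin t - (t - t ^ 3 / 6)) / t := by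
    field_simp
  have h4 : |t| ^ 4 = t ^ 4 := Even.pow_abs (⟨2, rfl⟩ : Even 4) t
  rw [hid, abs_div, div_le_iff₀ (abs_pos.2 h0)]
  calc |Real.sin t - (t - t ^ 3 / 6)| ≤ |t| ^ 5 / 100 := hb
    _ = t ^ 4 / 100 * |t| := by rw [← h4]; ring

/-- **T-S5.4d with the explicit constant `C = 1`.** -/
theorem haarDensityFlat_one {t : ℝ} (ht : |t| ≤ 1) :
    |Real.log ((2 * Real.pi ^ 2) * sigmaSU2 t) + t ^ 2 / 3| ≤ t ^ 4 := by
  rw [two_pi_sq_mul_sigmaSU2]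
  by_cases h0 : t = 0
  · subst h0; simp
  rw [if_neg h0]
  set s := Real.sin t / t with hs
  have he : |s - (1 - t ^ 2 / 6)| ≤ t ^ 4 / 100 := abs_sin_div_sub_le ht h0
  have ht2 : t ^ 2 ≤ 1 := by
    have h4 : |t| ^ 2 ≤ 1 := by nlinarith [abs_nonneg t]
    rwa [sq_abs] at h4
  have ht4 : t ^ 4 ≤ t ^ 2 := by nlinarith [sq_nonneg t]
  set u := 1 - s with hu
  have hu_bd : |u - t ^ 2 / 6| ≤ t ^ 4 / 100 := by
    have : u - t ^ 2 / 6 = -(s - (1 - t ^ 2 / 6)) := by rw [hu]; ring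
    rw [this, abs_neg]; exact he
  have hu1 := abs_le.1 hu_bd
  have hu_abs : |u| ≤ t ^ 2 / 6 + t ^ 4 / 100 := by
    rw [abs_le]; constructor <;> nlinarith [sq_nonneg t]
  have hu5 : |u| ≤ 1 / 5 := by linarith
  have hu_lt : |u| < 1 := by linarith
  have h1u : 1 - u = s := by rw [hu]; ring
  -- `log s² = 2 log s` and `log s = log (1 - u) = -u + O(u²)`
  have hlog : |u + Real.log s| ≤ |u| ^ 2 / (1 - |u|) := by
    have h := Real.abs_log_sub_add_sum_range_le hu_lt 1
    rw [Finset.sum_range_one, h1u] at h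
    simpa using h
  have hρ : |u + Real.log s| ≤ 5 / 4 * u ^ 2 := by
    refine hlog.trans ?_
    rw [sq_abs, div_le_iff₀ (by linarith)]
    nlinarith [sq_nonneg u, abs_nonneg u]
  rw [Real.log_pow, Nat.cast_ofNat]
  have hident : 2 * Real.log s + t ^ 2 / 3 = 2 * (u + Real.log s) - 2 * (u - t ^ 2 / 6) := by ring
  rw [hident]
  have hu2 : u ^ 2 ≤ (t ^ 2 / 6 + t ^ 4 / 100) ^ 2 := by
    rw [← sq_abs]; exact pow_le_pow_left₀ (abs_nonneg u) hu_abs 2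
  calc |2 * (u + Real.log s) - 2 * (u - t ^ 2 / 6)|
      ≤ |2 * (u + Real.log s)| + |2 * (u - t ^ 2 / 6)| := abs_sub _ _
    _ = 2 * |u + Real.log s| + 2 * |u - t ^ 2 / 6| := by rw [abs_mul, abs_mul, abs_two]
    _ ≤ 2 * (5 / 4 * u ^ 2) + 2 * (t ^ 4 / 100) := by gcongr
    _ ≤ t ^ 4 := by nlinarith [sq_nonneg (t ^ 2)]

/-- **T-S5.4d: Haar density flatness.** -/
theorem haarDensityFlat : HaarDensityFlat :=
  ⟨1, fun t ht => by rw [one_mul]; exact haarDensityFlat_one ht⟩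

end Summit.QuantumFields.YangMills.Theorems.AllWindowsColdBoxBoxHighLine

end
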